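import Summits.AtomisticToContinuum.HydrodynamicLimit.Theorems.OneFlightGossipEngineClampedTransferDockWindowClauseRate
import Summits.AtomisticToContinuum.HydrodynamicLimit.Theorems.OneFlightGossipEngineClampedTransferDockLedgerEndD
import Summits.AtomisticToContinuum.HydrodynamicLimit.Theorems.ImplosionDichotomyHydroLimitInBandWindowContinuity
import Summits.AtomisticToContinuum.HydrodynamicLimit.Theorems.ImplosionDichotomyHydroLimitInBandActivityTailsOfTransfer
import HarnessLib

/-!
# The dock `ClampedTransferDock` from SEET, the band exponential moment and the two transfer-clamp inputs
# (line `Sketch` of crux stmt-AtomisticToContinuum-17615 — its conditional closing, sorry-free)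

Support file (`--supports stmt-AtomisticToContinuum-17615`; registered sub-goal `clampedTransferDock_of_inputs` of the skeleton
`Cruxes/ClampedTransferDock/Lines/Sketch.lean` v4). The line re-threads the suprathermal cubic channel of the shared one-window heart at a
RATE (band `(K⋆, K₁]` paid inside the Grönwall by the running entropy at the small tilt `(8 Θ̄ K₁)⁻¹`, top `> K₁` by super-exponential
true-law cubic tails), so that the true-law dynamical child (ii) `CoherentSuprathermalContentVanishesW` of the heart's composition
(`Theorems.clampedTransferDock_of_heart`) is replaced by the pair SEET (true law, fixed-time marginals only) +
`BandCoherenceLDFamily` (reference law). With the four plumbing stubs of the line LANDED —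
`ClampedTransferDockRate.stub_windowEstimateRate` (p136014), `ClampedTransferDockCubicRate.stub_cubicChannelRate` (p138311),
`ClampedTransferDockRate.stub_windowClauseRate` (p139114), `ClampedTransferDockLedgerEndD.stub_ledgerEndD` (p139514) — the dock follows
from exactly four conjecture-grade inputs:

* `clampedTransferDock_of_inputs : SEET → BandCoherenceLDFamily → (iii) → (iv) → ClampedTransferDock`;
* `clampedTransferDock_of_inputs_transfer` — the same with (iv) `CollisionEnergyActivityTails` AND the dock's own binder CAT read off
  the single transfer-activity tails statement `ClampedCurrentsDockTransferTails.TransferActivityTails` (byte-identical with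
  `TwoClocks.TransferActivityTails`, stmt-AtomisticToContinuum-16624) through the landed `activityTails_of_transferActivityTails`.

Quantifier plumbing over landed theorems only; the mathematics is in the four landed stub files and the heart. [cite: Yau1991, §2]
-/

noncomputable section

namespace Summit.AtomisticToContinuum.HydrodynamicLimit.Theorems.ClampedTransferDockSketch

open Summit.AtomisticToContinuum.HydrodynamicLimit.Theses
open Summit.AtomisticToContinuum.HydrodynamicLimit.Theorems
open Summit.AtomisticToContinuum.HydrodynamicLimit.Theorems.HydroLimitInBandOfHeart
  (GronwallCoreInBand LocalClampedTransferWindowLDFamily CollisionEnergyActivityTails KineticCurrentsWindowLDFamily)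
open Summit.AtomisticToContinuum.HydrodynamicLimit.Theorems.ClampedCurrentsDockFromWindows (WindowContinuityInBand)
open Summit.AtomisticToContinuum.HydrodynamicLimit.Theorems.ClampedTransferDockCubicRate
  (SuperExponentialEnergyTails BandCoherenceLDFamily stub_cubicChannelRate)
open Summit.AtomisticToContinuum.HydrodynamicLimit.Theorems.ClampedTransferDockRate (stub_windowEstimateRate stub_windowClauseRate)
open Summit.AtomisticToContinuum.HydrodynamicLimit.Theorems.ClampedTransferDockLedgerEndD (stub_ledgerEndD)

/-- **The dock from SEET, the band exponential moment, (iii) and (iv)** (registered sub-goal `clampedTransferDock_of_inputs` of line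
`Sketch`, crux stmt-AtomisticToContinuum-17615). KCWF is the heart's `KineticCurrentsWindowLDFamily` definitionally; the landed rate
window clause, fed the landed per-window estimate with slack and the landed rate cubic channel, gives the D-shape one-window ledger
(`∀ δ ∃ K ∃ ε, 4(1+t) ε e^{2Kt} ≤ δ`); the landed window continuity takes CAT, (iv), ECT; the landed D-shape ledger end with the landed
a-priori bound gives the guarded Grönwall core; `relEntropyVanishingInBand_of_gronwallCoreInBand` and
`hydroLimitInBand_of_relEntropyVanishingInBand` conclude, `ImplosionDichotomy.HydroLimitInBand` being the re-typed conjunct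
`HydrodynamicLimit` (same term). [cite: Yau1991, §2] -/
theorem clampedTransferDock_of_inputs : Summit.AtomisticToContinuum.HydrodynamicLimit.Theorems.ClampedTransferDockCubicRate.SuperExponentialEnergyTails → Summit.AtomisticToContinuum.HydrodynamicLimit.Theorems.ClampedTransferDockCubicRate.BandCoherenceLDFamily → Summit.AtomisticToContinuum.HydrodynamicLimit.Theorems.HydroLimitInBandOfHeart.LocalClampedTransferWindowLDFamily → Summit.AtomisticToContinuum.HydrodynamicLimit.Theorems.HydroLimitInBandOfHeart.CollisionEnergyActivityTails → Summit.AtomisticToContinuum.HydrodynamicLimit.Theses.OneFlightGossipEngine.ClampedTransferDock := by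
  intro hS hB h₃ h₄ hK h₇ h₆
  have hKF : KineticCurrentsWindowLDFamily := hK
  have hOW := stub_windowClauseRate stub_windowEstimateRate stub_cubicChannelRate hB hS h₃ h₄ hKF h₇ h₆
  have hC : WindowContinuityInBand := HydroLimitInBandContinuity.stub_windowContinuityInBand h₇ h₄ h₆
  have hG : GronwallCoreInBand := stub_ledgerEndD hOW hC EntropyClockDock.ledgerAprioriBound
  exact Theorems.hydroLimitInBand_of_relEntropyVanishingInBand
    (EntropyClockDock.relEntropyVanishingInBand_of_gronwallCoreInBand hG)

/-- **The dock from SEET, the band exponential moment, (iii) and the transfer-activity tails.** The single statement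
`ClampedCurrentsDockTransferTails.TransferActivityTails` (byte-identical with `TwoClocks.TransferActivityTails`, stmt-16624) gives both
the dock's binder CAT and child (iv) by the landed `HydroLimitInBandHeart.activityTails_of_transferActivityTails`; the CAT binder of the
dock is then idle. [cite: Yau1991, §2] -/
theorem clampedTransferDock_of_inputs_transfer : Summit.AtomisticToContinuum.HydrodynamicLimit.Theorems.ClampedTransferDockCubicRate.SuperExponentialEnergyTails → Summit.AtomisticToContinuum.HydrodynamicLimit.Theorems.ClampedTransferDockCubicRate.BandCoherenceLDFamily → Summit.AtomisticToContinuum.HydrodynamicLimit.Theorems.HydroLimitInBandOfHeart.LocalClampedTransferWindowLDFamily → Summit.AtomisticToContinuum.HydrodynamicLimit.Theorems.ClampedCurrentsDockTransferTails.TransferActivityTails → Summit.AtomisticToContinuum.HydrodynamicLimit.Theses.OneFlightGossipEngine.ClampedTransferDock :=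
  fun hS hB h₃ hT hK _ h₆ =>
    clampedTransferDock_of_inputs hS hB h₃ (HydroLimitInBandHeart.activityTails_of_transferActivityTails hT).2 hK
      (HydroLimitInBandHeart.activityTails_of_transferActivityTails hT).1 h₆

end Summit.AtomisticToContinuum.HydrodynamicLimit.Theorems.ClampedTransferDockSketch

end
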